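import Literature.Computability.QuantumComplexity.PerSearchRoundsBrick
import Literature.Computability.Complexity.ListFoldBricks
import HarnessLib

/-!
# The post-phase of a level of the AA13 permanent search as an `FP` brick: clamp, rounds, rounding

Aaronson–Arkhipov, *The computational complexity of linear optics*, Theory of Computing 9 (2013),
proof of Thm. 4.3, eqs. (4.16)–(4.19) (p. 177): with `Per(Y)` of the minor known, `T` rounds of the
search are run and `r(T) · Per(Y)` is rounded to the integer `Per(X)`. In the tree this is the
post-phase `PerSearch.levelPost mk g X p v₀ P_Y` (`PermanentSearchReplay.lean`: the clamp
`P_Y = 0 ∨ n! < P_Y ↦ 0`, `iterM searchRound (rounds g n) (0, 0, v₀)` on the row-permuted matrix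
`topMatrix X p`, `round (r · P_Y)`), with the closed form `replay_levelPost`. This file realises it:

* `tailF G c q₀` on the record `⟨inp, ⟨⟨w', ⟨1^{m+1}, bin v₀⟩⟩, ⟨bin P_Y, ansEnc as⟩⟩⟩` (`w'` the word of
  the matrix searched, of dimension `m + 1`): the clamp test (`factUF` of `1ᵐ` against `bin P_Y`), the
  rounds loop `roundsLoopF` of `PerSearchRoundsBrick.lean` from the initial state, and the read-out —
  the pending query, or the rounding `qroundF` of `num(r) · P_Y / den(r)` (`RatBricks.lean`) clipped at
  `0` by `toNat` (the first component of the difference pair); `tailF ∈ FP`;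
* `tailF_apply` — its value in terms of `replay (iterM (searchRound (randMaker G c q₀ u) …) …)` for an
  arbitrary word `w'`, and **`tailF_levelPost`** — for `w' = permW (m+1) w p` it realises
  `replay (levelPost (randMaker G c q₀ u) G (wmat (m+1) w) p v₀ P_Y) as` (`wmat_permW` identifies the
  word of the permuted matrix with `topMatrix`): output `⟨ε, ⟨ansEnc as', bin v⟩⟩` on `inr (v, as')`,
  `⟨1 q, ⟨ansEnc ε, ε⟩⟩` on a pending `q`.

## References

* S. Aaronson, A. Arkhipov, *The computational complexity of linear optics*, Theory of Computing 9
  (2013), proof of Thm. 4.3, eqs. (4.16)–(4.19) (p. 177).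
* S. Arora, B. Barak, *Computational Complexity: A Modern Approach*, CUP 2009, §1.3, §3.4.
-/

noncomputable section

namespace Literature.Computability.QuantumComplexity

open _root_.Computability Complexity Complexity.Brick Complexity.Plumb Complexity.OracleComp Matrix
  Literature.Computability.AlgebraicComplexity Polynomial

namespace PerSearch

/-! ### The record of the post-phase -/

/-- **The input record of the post-phase**: machine input, the word searched with its dimension and first
value, the minor's permanent, the transcript. [folklore] -/
def tailRec (inp : List Bool) (m : ℕ) (w' : List Bool) (v0 PY : ℕ) (as : List (List Bool)) : List Bool :=
  boolPair inp (boolPair (boolPair w' (boolPair (ones (m + 1)) (encodeNat v0))) (boolPair (encodeNat PY) (ansEnc as)))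

/-- Machine input. [folklore] -/
def tInp : List Bool → List Bool := nthF 0
/-- The word searched. [folklore] -/
def tW : List Bool → List Bool := nthF 0 ∘ nthF 1
/-- The dimension in unary. [folklore] -/
def tK : List Bool → List Bool := nthF 1 ∘ nthF 1
/-- `bin v₀`. [folklore] -/
def tV : List Bool → List Bool := sndPow 1 ∘ nthF 1
/-- `bin P_Y`. [folklore] -/
def tP : List Bool → List Bool := nthF 2
/-- The transcript. [folklore] -/
def tAS : List Bool → List Bool := sndPow 2

section TProj
variable (inp : List Bool) (m : ℕ) (w' : List Bool) (v0 PY : ℕ) (as : List (List Bool))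
/-- Value of `tInp`. [folklore] -/
@[simp] theorem tInp_tailRec : tInp (tailRec inp m w' v0 PY as) = inp := by simp [tInp, tailRec]
/-- Value of `tW`. [folklore] -/
@[simp] theorem tW_tailRec : tW (tailRec inp m w' v0 PY as) = w' := by simp [tW, tailRec, nthF]
/-- Value of `tK`. [folklore] -/
@[simp] theorem tK_tailRec : tK (tailRec inp m w' v0 PY as) = ones (m + 1) := by simp [tK, tailRec, nthF]
/-- Value of `tV`. [folklore] -/
@[simp] theorem tV_tailRec : tV (tailRec inp m w' v0 PY as) = encodeNat v0 := by simp [tV, tailRec, nthF, sndPow]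
/-- Value of `tP`. [folklore] -/
@[simp] theorem tP_tailRec : tP (tailRec inp m w' v0 PY as) = encodeNat PY := by simp [tP, tailRec, nthF]
/-- Value of `tAS`. [folklore] -/
@[simp] theorem tAS_tailRec : tAS (tailRec inp m w' v0 PY as) = ansEnc as := by simp [tAS, tailRec, sndPow]
end TProj

/-- The projections are in `FP`. [cite: AroraBarak2009, §1.3] -/
theorem tproj_mem_FP : tInp ∈ FP ∧ tW ∈ FP ∧ tK ∈ FP ∧ tV ∈ FP ∧ tP ∈ FP ∧ tAS ∈ FP :=
  ⟨nthF_mem_FP 0, comp_mem_FP (nthF_mem_FP 0) (nthF_mem_FP 1), comp_mem_FP (nthF_mem_FP 1) (nthF_mem_FP 1),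
    comp_mem_FP (sndPow_mem_FP 1) (nthF_mem_FP 1), nthF_mem_FP 2, sndPow_mem_FP 2⟩

/-! ### The clamp, the initial rounds record, the rounding -/

/-- **The clamp test** `[P_Y = 0 ∨ m! < P_Y]` (`m!` by `factUF` of the dimension minus one). [cite: AaronsonArkhipovToC2013, proof of Thm. 4.3 (p. 177)] -/
def clampT : List Bool → List Bool :=
  orFn (isNilFn ∘ tP) (ltFn ∘ fanoutFn (factUF ∘ dropFn ∘ fanoutFn (fun _ => [true]) tK) tP)

/-- Value of the clamp test. [folklore] -/
theorem clampT_tailRec (inp : List Bool) (m : ℕ) (w' : List Bool) (v0 PY : ℕ) (as : List (List Bool)) :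
    clampT (tailRec inp m w' v0 PY as) = [decide (PY = 0 ∨ m.factorial < PY)] := by
  have h1 : (isNilFn ∘ tP) (tailRec inp m w' v0 PY as) = [decide (PY = 0)] := by
    simp only [Function.comp_apply, tP_tailRec, isNilFn]
    congr 1
    apply Bool.decide_congr
    constructor
    · intro h; have := congrArg bitsToNat h; simpa using this
    · rintro rfl; rfl
  have h2 : (ltFn ∘ fanoutFn (factUF ∘ dropFn ∘ fanoutFn (fun _ => [true]) tK) tP) (tailRec inp m w' v0 PY as) =
      [decide (m.factorial < PY)] := by
    simp [factF_apply, ones]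
  rw [clampT, orFn_apply h1 h2]
  simp [Bool.decide_or]

/-- `clampT ∈ FP`. [cite: AroraBarak2009, §1.3] -/
theorem clampT_mem_FP : clampT ∈ FP :=
  orFn_mem_FP (comp_mem_FP isNilFn_mem_FP tproj_mem_FP.2.2.2.2.1)
    (comp_mem_FP ltFn_mem_FP (fanoutFn_mem_FP (comp_mem_FP factF_mem_FP (comp_mem_FP dropFn_mem_FP
      (fanoutFn_mem_FP (const_mem_FP _) tproj_mem_FP.2.2.1))) tproj_mem_FP.2.2.2.2.1))

/-- The code `stEnc (0, 0, v₀)` has the constant prefix `⟨ε, ⟨qEnc 0, ·⟩⟩`. [folklore] -/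
theorem stEnc_init (v0 : ℕ) : stEnc (0, 0, v0) = boolPair [] (boolPair (qEnc 0) (encodeNat v0)) := by
  simp [stEnc, (by decide : encodeNat 0 = [])]

/-- **The initial record of the rounds loop**: `⟨inp, ⟨bin (rounds G m), stateEnc [] as m w' P_Y (0, 0, v₀)⟩⟩`. [folklore] -/
def rInitF (G : ℕ) : List Bool → List Bool :=
  fanoutFn tInp (fanoutFn (roundsF G ∘ factUF ∘ tK)
    (fanoutFn (fun _ => []) (fanoutFn tAS (fanoutFn (fanoutFn tW (fanoutFn tK (fanoutFn tP (factUF ∘ tK))))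
      (fanoutFn (fun _ => []) (fanoutFn (fun _ => qEnc 0) tV))))))

/-- Value of the initial record. [folklore] -/
theorem rInitF_tailRec (G : ℕ) (inp : List Bool) (m : ℕ) (w' : List Bool) (v0 PY : ℕ) (as : List (List Bool)) :
    rInitF G (tailRec inp m w' v0 PY as) = boolPair inp (boolPair (encodeNat (rounds G m)) (stateEnc [] as m w' PY (0, 0, v0))) := by
  simp only [rInitF, fanoutFn_apply, Function.comp_apply, tInp_tailRec, tK_tailRec, tAS_tailRec, tW_tailRec, tP_tailRec, tV_tailRec,
    factF_apply, stateEnc, fdEnc, stEnc_init]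
  rw [show (ones (m + 1)).length = m + 1 by simp [ones], roundsF_eq_rounds]

/-- `rInitF G ∈ FP`. [cite: AroraBarak2009, §1.3] -/
theorem rInitF_mem_FP (G : ℕ) : rInitF G ∈ FP := by
  obtain ⟨hI, hW, hK, hV, hP, hAS⟩ := tproj_mem_FP
  exact fanoutFn_mem_FP hI (fanoutFn_mem_FP (comp_mem_FP (roundsF_mem_FP G) (comp_mem_FP factF_mem_FP hK))
    (fanoutFn_mem_FP (const_mem_FP _) (fanoutFn_mem_FP hAS (fanoutFn_mem_FP (fanoutFn_mem_FP hW (fanoutFn_mem_FP hK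
      (fanoutFn_mem_FP hP (comp_mem_FP factF_mem_FP hK)))) (fanoutFn_mem_FP (const_mem_FP _) (fanoutFn_mem_FP (const_mem_FP _) hV))))))

/-- On `⟨qEnc r, bin P_Y⟩`: **`bin (round (r · P_Y)).toNat`** — the rounding of `num(r) P_Y / den(r)` and the
nonnegative part of the difference pair. [cite: AaronsonArkhipovToC2013, proof of Thm. 4.3, eq. (4.19) (p. 177)] -/
def roundMulF : List Bool → List Bool :=
  fstF ∘ qroundF ∘ fanoutFn (zmulF ∘ fanoutFn (fstF ∘ fstF) (nzF ∘ sndF)) (sndF ∘ fstF)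

/-- **Value of `roundMulF`** (`P_Y > 0` is not needed: `r · 0` rounds to `0`… but the denominator must be
positive, which `den r` is). [folklore] -/
theorem roundMulF_apply (r : ℚ) (PY : ℕ) : roundMulF (boolPair (qEnc r) (encodeNat PY)) = encodeNat (round (r * PY)).toNat := by
  simp only [roundMulF, Function.comp_apply, fanoutFn_apply, fstF_boolPair, sndF_boolPair, fstF_qEnc, sndF_qEnc, zmulF_boolPair,
    ival_dpEnc, ival_nzF, bitsToNat_encodeNat]
  rw [qroundF_dpEnc _ r.den_pos]
  have e : ((r.num * (PY : ℤ) : ℤ) : ℚ) / (r.den : ℚ) = r * PY := by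
    push_cast
    rw [div_eq_iff (by exact_mod_cast r.den_pos.ne' : (r.den : ℚ) ≠ 0), mul_right_comm, Rat.mul_den_eq_num]
  rw [e, dpEnc, fstF_boolPair]

/-- `roundMulF ∈ FP`. [cite: AroraBarak2009, §1.3] -/
theorem roundMulF_mem_FP : roundMulF ∈ FP :=
  comp_mem_FP fstF_mem_FP (comp_mem_FP qroundF_mem_FP (fanoutFn_mem_FP
    (comp_mem_FP zmulF_mem_FP (fanoutFn_mem_FP (comp_mem_FP fstF_mem_FP fstF_mem_FP) (comp_mem_FP nzF_mem_FP sndF_mem_FP)))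
    (comp_mem_FP sndF_mem_FP fstF_mem_FP)))

/-! ### The post-phase -/

/-- **Read-out of the rounds loop** on `⟨tail record, loop output⟩`: the status and transcript of the final
state; on a running final state the rounded result `bin (round (r P_Y)).toNat`, else `ε`. [folklore] -/
def tailOutF : List Bool → List Bool :=
  fanoutFn (rS ∘ sndPow 1 ∘ sndF) (fanoutFn (rAS ∘ sndPow 1 ∘ sndF)
    (iteFn (isNilFn ∘ rS ∘ sndPow 1 ∘ sndF) (roundMulF ∘ fanoutFn (nthF 1 ∘ rST ∘ sndPow 1 ∘ sndF) (tP ∘ fstF)) fun _ => []))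

/-- `tailOutF ∈ FP`. [cite: AroraBarak2009, §1.3] -/
theorem tailOutF_mem_FP : tailOutF ∈ FP := by
  have hst : (sndPow 1 ∘ sndF) ∈ FP := comp_mem_FP (sndPow_mem_FP 1) sndF_mem_FP
  have hS : (rS ∘ sndPow 1 ∘ sndF) ∈ FP := comp_mem_FP (nthF_mem_FP 0) hst
  exact fanoutFn_mem_FP hS (fanoutFn_mem_FP (comp_mem_FP (nthF_mem_FP 1) hst)
    (iteFn_mem_FP (comp_mem_FP isNilFn_mem_FP hS) (comp_mem_FP roundMulF_mem_FP (fanoutFn_mem_FP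
      (comp_mem_FP (nthF_mem_FP 1) (comp_mem_FP (sndPow_mem_FP 2) hst)) (comp_mem_FP tproj_mem_FP.2.2.2.2.1 fstF_mem_FP)))
      (const_mem_FP _)))

/-- Read-out of a running final state. [folklore] -/
theorem tailOutF_running (tr inp : List Bool) (m : ℕ) (w' : List Bool) (v0 PY : ℕ) (as as' : List (List Bool)) (st : ℕ × ℚ × ℕ)
    (htr : tr = tailRec inp m w' v0 PY as) :
    tailOutF (boolPair tr (boolPair inp (boolPair [] (stateEnc [] as' m w' PY st)))) =
      boolPair [] (boolPair (ansEnc as') (encodeNat (round (st.2.1 * PY)).toNat)) := by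
  subst htr
  rw [tailOutF, fanoutFn_apply, fanoutFn_apply, iteFn_apply (b := true) (by simp [rS, isNilFn, nthF, sndPow, stateEnc])]
  simp [rS, rAS, rST, nthF, sndPow, stateEnc, stEnc, roundMulF_apply]

/-- Read-out of a pending final state. [folklore] -/
theorem tailOutF_pending (tr inp : List Bool) (m : ℕ) (w' : List Bool) (PY : ℕ) (q : List Bool) (as' : List (List Bool)) (st : ℕ × ℚ × ℕ) :
    tailOutF (boolPair tr (boolPair inp (boolPair [] (stateEnc (true :: q) as' m w' PY st)))) =
      boolPair (true :: q) (boolPair (ansEnc as') []) := by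
  rw [tailOutF, fanoutFn_apply, fanoutFn_apply, iteFn_apply (b := false) (by simp [rS, isNilFn, nthF, sndPow, stateEnc])]
  simp [rS, rAS, nthF, sndPow, stateEnc]

/-- **The post-phase of a level**: clamp (`⟨ε, ⟨transcript, bin 0⟩⟩`), else the rounds loop and its read-out. [cite: AaronsonArkhipovToC2013, proof of Thm. 4.3, eqs. (4.16)–(4.19) (p. 177)] -/
def tailF (G : ℕ) (c q₀ : Polynomial ℕ) : List Bool → List Bool :=
  iteFn clampT (fanoutFn (fun _ => []) (fanoutFn tAS fun _ => [])) (tailOutF ∘ fanoutFn id (roundsLoopF G c q₀ ∘ rInitF G))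

/-- **`tailF G c q₀ ∈ FP`.** [cite: AroraBarak2009, §1.3] -/
theorem tailF_mem_FP (G : ℕ) (c q₀ : Polynomial ℕ) : tailF G c q₀ ∈ FP :=
  iteFn_mem_FP clampT_mem_FP (fanoutFn_mem_FP (const_mem_FP _) (fanoutFn_mem_FP tproj_mem_FP.2.2.2.2.2 (const_mem_FP _)))
    (comp_mem_FP tailOutF_mem_FP (fanoutFn_mem_FP OracleCompose.id_mem_FP (comp_mem_FP (roundsLoopF_mem_FP G c q₀) (rInitF_mem_FP G))))

/-- **Value of the post-phase brick** on `tailRec ⟨u, A⟩ m w' v₀ P_Y as` (for `|w'| = (m+1)²`, `m + 1 ≤ |inp|`,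
the first value and all transcript values of at most `|inp| + 1` bits): the clamp, else the replay of the
rounds of `searchRound` on `wmat (m+1) w'`, rounded. [cite: AaronsonArkhipovToC2013, proof of Thm. 4.3, eqs. (4.16)–(4.19) (p. 177)] -/
theorem tailF_apply (G : ℕ) (c q₀ : Polynomial ℕ) (u A : List Bool) (m : ℕ) {w' : List Bool} (hw : w'.length = (m + 1) * (m + 1))
    (hmN : m + 1 ≤ (boolPair u A).length) {v0 : ℕ} (hv0 : (encodeNat v0).length ≤ (boolPair u A).length + 1) (PY : ℕ)
    {as : List (List Bool)} (hA : ∀ a ∈ as, (encodeNat (decodeNat a)).length ≤ (boolPair u A).length + 1) :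
    tailF G c q₀ (tailRec (boolPair u A) m w' v0 PY as) =
      if PY = 0 ∨ m.factorial < PY then boolPair [] (boolPair (ansEnc as) [])
      else match replay (iterM (searchRound (randMaker G c q₀ u) G (m + 1) (wmat (m + 1) w') PY) (rounds G m) (0, 0, v0)) as with
        | Sum.inr (st, as') => boolPair [] (boolPair (ansEnc as') (encodeNat (round (st.2.1 * PY)).toNat))
        | Sum.inl q => boolPair (true :: q) (boolPair (ansEnc []) []) := by
  rw [tailF, iteFn_apply (clampT_tailRec _ m w' v0 PY as)]
  by_cases hcl : PY = 0 ∨ m.factorial < PY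
  · rw [decide_eq_true hcl, if_pos rfl, if_pos hcl]
    simp
  · rw [decide_eq_false hcl, if_neg Bool.false_ne_true, if_neg hcl]
    have hPY0 : 0 < PY := Nat.pos_of_ne_zero fun h => hcl (Or.inl h)
    have hPYle : PY ≤ (m + 1).factorial := (not_lt.1 fun h => hcl (Or.inr h)).trans (Nat.factorial_le (Nat.le_succ m))
    simp only [Function.comp_apply, fanoutFn_apply, id, rInitF_tailRec,
      roundsLoopF_apply G c q₀ u A m hw hPY0 hPYle hmN hv0 hA]
    rcases replay (iterM (searchRound (randMaker G c q₀ u) G (m + 1) (wmat (m + 1) w') PY) (rounds G m) (0, 0, v0)) as with q | ⟨st, as'⟩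
    · exact tailOutF_pending _ _ m w' PY q [] _
    · exact tailOutF_running _ _ m w' v0 PY as as' st rfl

/-- **The post-phase brick realises `levelPost`**: with the word `permW (m+1) w p` of the row-permuted matrix
(`topMatrix (wmat (m+1) w) p`, `wmat_permW`), `tailF` returns the replay of
`levelPost (randMaker G c q₀ u) G (wmat (m+1) w) p v₀ P_Y`. [cite: AaronsonArkhipovToC2013, proof of Thm. 4.3, eqs. (4.16)–(4.19) (p. 177)] -/
theorem tailF_levelPost (G : ℕ) (c q₀ : Polynomial ℕ) (u A : List Bool) (m : ℕ) {w : List Bool} (hw : w.length = (m + 1) * (m + 1))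
    (p : Fin (m + 1)) (hmN : m + 1 ≤ (boolPair u A).length) {v0 : ℕ} (hv0 : (encodeNat v0).length ≤ (boolPair u A).length + 1)
    (PY : ℕ) {as : List (List Bool)} (hA : ∀ a ∈ as, (encodeNat (decodeNat a)).length ≤ (boolPair u A).length + 1) :
    tailF G c q₀ (tailRec (boolPair u A) m (permW (m + 1) w p) v0 PY as) =
      match replay (levelPost (randMaker G c q₀ u) G (wmat (m + 1) w) p v0 PY) as with
      | Sum.inr (v, as') => boolPair [] (boolPair (ansEnc as') (encodeNat v))
      | Sum.inl q => boolPair (true :: q) (boolPair (ansEnc []) []) := by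
  rw [tailF_apply G c q₀ u A m (length_permW hw p.2) hmN hv0 PY hA, replay_levelPost, wmat_permW w hw p]
  by_cases hcl : PY = 0 ∨ m.factorial < PY
  · rw [if_pos hcl, if_pos hcl]
    show boolPair [] (boolPair (ansEnc as) []) = boolPair [] (boolPair (ansEnc as) (encodeNat 0))
    rw [(by decide : encodeNat 0 = [])]
  · rw [if_neg hcl, if_neg hcl]
    show (match replay (iterM (searchRound (randMaker G c q₀ u) G (m + 1) (topMatrix (wmat (m + 1) w) p) PY) (rounds G m) (0, 0, v0)) as with
      | Sum.inr (st, as') => boolPair [] (boolPair (ansEnc as') (encodeNat (round (st.2.1 * PY)).toNat))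
      | Sum.inl q => boolPair (true :: q) (boolPair (ansEnc []) [])) = _
    rcases replay (iterM (searchRound (randMaker G c q₀ u) G (m + 1) (topMatrix (wmat (m + 1) w) p) PY) (rounds G m) (0, 0, v0)) as
      with q | ⟨st, as'⟩ <;> rfl

/-! ### The size of the value returned by the post-phase -/

/-- The exponent bounding the value returned by a level of dimension `m + 1`: `RB G m + (G + 1 + (m+1)²) + (m+1)² + 1`. [folklore] -/
def pyE (G m : ℕ) : ℕ := RB G m + (G + 1 + (m + 1) ^ 2) + (m + 1) ^ 2 + 1

/-- `pyE` is monotone in the dimension. [folklore] -/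
theorem pyE_mono {G m m' : ℕ} (h : m ≤ m') : pyE G m ≤ pyE G m' := by
  unfold pyE
  have := RB_mono (g := G) h
  gcongr

/-- **The value returned by the post-phase is below `2^{pyE}`**: `0` from the clamp, else
`(round (r · P_Y)).toNat ≤ |r| P_Y + 1` with `|r| ≤ T (G (m+1)! + 1)` (`USz` after the rounds) and
`P_Y ≤ m!`. [cite: AaronsonArkhipovToC2013, proof of Thm. 4.3, eq. (4.19) (p. 177)] -/
theorem levelPost_value_lt (mk : Maker) (G : ℕ) {m : ℕ} (X : Matrix (Fin (m + 1)) (Fin (m + 1)) ℤ) (p : Fin (m + 1)) (v0 PY : ℕ)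
    {as as' : List (List Bool)} {v : ℕ} (h : replay (levelPost mk G X p v0 PY) as = Sum.inr (v, as')) : v < 2 ^ pyE G m := by
  rw [replay_levelPost] at h
  by_cases hcl : PY = 0 ∨ m.factorial < PY
  · rw [if_pos hcl] at h
    simp only [Sum.inr.injEq, Prod.mk.injEq] at h
    rw [← h.1]
    exact Nat.one_le_two_pow
  · rw [if_neg hcl] at h
    have hPY0 : 0 < PY := Nat.pos_of_ne_zero fun h0 => hcl (Or.inl h0)
    have hPYm : PY ≤ m.factorial := not_lt.1 fun h1 => hcl (Or.inr h1)
    rcases hit : replay (iterM (searchRound mk G (m + 1) (topMatrix X p) PY) (rounds G m) (0, 0, v0)) as with q | ⟨st, as''⟩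
    · rw [hit] at h; cases h
    · rw [hit] at h
      simp only [Sum.inr.injEq, Prod.mk.injEq] at h
      obtain ⟨rfl, -⟩ := h
      obtain ⟨husz, -, -, -⟩ := iterM_searchRound_usz hPY0 mk (m + 1) (topMatrix X p) (rounds G m) 0 (usz_init G m PY v0) hit
      rw [Nat.zero_add] at husz
      obtain ⟨-, habs⟩ := husz
      -- `(round (r P_Y)).toNat ≤ |r| P_Y + 1 < 2^T · 2^{G+1+(m+1)²} · 2^{(m+1)²} · 2`
      have hT : (rounds G m : ℚ) < (2 ^ RB G m : ℕ) := by
        exact_mod_cast lt_of_le_of_lt (rounds_le_RB' G m) Nat.lt_two_pow_self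
      have hg : G * ((m + 1).factorial : ℚ) + 1 < (2 ^ (G + 1 + (m + 1) ^ 2) : ℕ) := by exact_mod_cast gfact_lt_two_pow G m
      have hP : (PY : ℚ) < (2 ^ ((m + 1) ^ 2) : ℕ) := by
        exact_mod_cast lt_of_le_of_lt (hPYm.trans (Nat.factorial_le (Nat.le_succ m))) (factorial_succ_lt_two_pow_sq m)
      have hr0 : (0 : ℚ) ≤ |st.2.1| := abs_nonneg _
      have hP0 : (0 : ℚ) ≤ PY := by positivity
      have hrPY : |st.2.1| * PY < (2 ^ RB G m : ℕ) * (2 ^ (G + 1 + (m + 1) ^ 2) : ℕ) * (2 ^ ((m + 1) ^ 2) : ℕ) := by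
        have h1 : |st.2.1| ≤ (rounds G m : ℚ) * (G * ((m + 1).factorial : ℚ) + 1) := habs
        have h2 : (rounds G m : ℚ) * (G * ((m + 1).factorial : ℚ) + 1) < (2 ^ RB G m : ℕ) * (2 ^ (G + 1 + (m + 1) ^ 2) : ℕ) :=
          mul_lt_mul'' hT hg (by positivity) (by positivity)
        calc |st.2.1| * PY ≤ (rounds G m : ℚ) * (G * ((m + 1).factorial : ℚ) + 1) * PY := mul_le_mul_of_nonneg_right h1 hP0
          _ < (2 ^ RB G m : ℕ) * (2 ^ (G + 1 + (m + 1) ^ 2) : ℕ) * (2 ^ ((m + 1) ^ 2) : ℕ) := by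
              rcases eq_or_lt_of_le hP0 with hP' | hP'
              · rw [← hP', mul_zero]; positivity
              · exact mul_lt_mul'' h2 hP (by positivity) hP0
      -- the rounding
      have hround : ((round (st.2.1 * PY)).toNat : ℚ) ≤ |st.2.1| * PY + 1 := by
        have h1 : ((round (st.2.1 * PY)).toNat : ℚ) ≤ |(round (st.2.1 * (PY : ℚ)) : ℚ)| := by
          have : ((round (st.2.1 * (PY : ℚ))).toNat : ℤ) ≤ |round (st.2.1 * (PY : ℚ))| := by
            have := Int.self_le_toNat (round (st.2.1 * (PY : ℚ)))
            rcases le_or_gt 0 (round (st.2.1 * (PY : ℚ))) with h0 | h0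
            · rw [Int.toNat_of_nonneg h0, abs_of_nonneg h0]
            · rw [Int.toNat_eq_zero.2 h0.le]; positivity
          exact_mod_cast this
        have h2 : |(round (st.2.1 * (PY : ℚ)) : ℚ)| ≤ |st.2.1 * PY| + 1 := by
          have h3 := abs_sub_round (st.2.1 * (PY : ℚ))
          have h4 : |(round (st.2.1 * (PY : ℚ)) : ℚ)| ≤ |(round (st.2.1 * (PY : ℚ)) : ℚ) - st.2.1 * PY| + |st.2.1 * PY| := by
            have := abs_add_le ((round (st.2.1 * (PY : ℚ)) : ℚ) - st.2.1 * PY) (st.2.1 * PY)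
            rwa [sub_add_cancel] at this
          rw [abs_sub_comm] at h4
          linarith
        rw [abs_mul, Nat.abs_cast] at h2
        linarith
      have hB : ((round (st.2.1 * PY)).toNat : ℚ) < ((2 ^ RB G m * 2 ^ (G + 1 + (m + 1) ^ 2) * 2 ^ ((m + 1) ^ 2) : ℕ) : ℚ) + 1 := by
        push_cast at hrPY ⊢
        linarith
      have hB' : (round (st.2.1 * PY)).toNat < 2 ^ RB G m * 2 ^ (G + 1 + (m + 1) ^ 2) * 2 ^ ((m + 1) ^ 2) + 1 := by exact_mod_cast hB
      have hpow : 2 ^ pyE G m = 2 ^ RB G m * 2 ^ (G + 1 + (m + 1) ^ 2) * 2 ^ ((m + 1) ^ 2) * 2 := by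
        rw [pyE, pow_add, pow_add, pow_add, pow_one]
      have hpos : 1 ≤ 2 ^ RB G m * 2 ^ (G + 1 + (m + 1) ^ 2) * 2 ^ ((m + 1) ^ 2) := Nat.one_le_iff_ne_zero.2 (by positivity)
      omega

end PerSearch

end Literature.Computability.QuantumComplexity

end
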